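import Mathlib
import Summits.AtomisticToContinuum.FouriersLaw.Theses.EmbeddedDrudeMourre
import HarnessLib

/-!
# The regularised pair spectral function as a Poisson integral — `stub_levelShiftPushforward` (stub B0) of line `swap-odd-threshold-rigidity`
(crux `EmbeddedDrudeMourre.MourreDissolution`, item stmt-AtomisticToContinuum-12594; helper file, `--supports`)

Registered stub B0 of the checked skeleton of line `swap-odd-threshold-rigidity` (lead c7), in the
skeleton's stub namespace `Summit.AtomisticToContinuum.FouriersLaw.Theorems.MourreDissolution`.

For the pinned band `ω(k) = √(ω₂ + 2 − 2 cos k)` (`ω₂ > 0`), a continuous profile `f`, the weight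
`W = Φ²/(ω₁ω₂ω₃ω₄)²·[f]²` (`Φ = vertex a b`, `[f] = f(k₁)+f(k₂)−f(k₃)−f(k₁+k₂−k₃)`) and the
resonance function `Ω = resonanceFn ω₂`, both read at the point `p = (k₁, (k₃, k₂))` of the cell
`(−π,π]³` (iterated product measure, matching the order of integration `dk₁ dk₃ dk₂`):
* the pushforward `m_f = Ω_*(W · dk)` is a finite measure on `ℝ` — `W` is continuous on `ℝ³`, hence
  integrable on the bounded cell (`ContinuousOn.integrableOn_compact` on the closed cube and
  `Measure.prod_restrict`), so `W · dk` is finite (`isFiniteMeasure_withDensity_ofReal`) and so is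
  its image;
* for `ν > 0` and every `E`, the triple cell integral `∫∫∫ W · ν/((Ω − E)² + ν²) dk₂ dk₃ dk₁` equals
  `∫ ν/((x − E)² + ν²) dm_f(x)` — Fubini twice (`integral_prod`, the integrand being continuous hence
  integrable on the cell), `integral_withDensity_eq_integral_smul` and `integral_map`.
Pure measure-theoretic plumbing; no cited facts.
-/

noncomputable section

namespace Summit.AtomisticToContinuum.FouriersLaw.Theorems.MourreDissolution

open MeasureTheory Filter Set Function Topology
open scoped InnerProductSpace ENNReal NNReal
open Literature.MathematicalPhysics.KineticTheory
open Literature.MathematicalPhysics.KineticTheory.PhononBoltzmann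

/-! ### Continuity of the vocabulary -/

/-- The pinned band `ω(k) = √(ω₂ + 2(1 − cos k))` is continuous in `k`. [folklore] -/
@[fun_prop]
theorem levelShift_continuous_dispersion (ω₂ : ℝ) : Continuous fun k : ℝ => dispersion ω₂ k := by
  unfold dispersion; fun_prop

/-- The vertex `Φ(k₁,k₂,k₃) = a + 16b ∏ sin(k_j/2)` is jointly continuous along continuous
arguments. [folklore] -/
@[fun_prop]
theorem levelShift_continuous_vertex {X : Type*} [TopologicalSpace X] {g₁ g₂ g₃ : X → ℝ}
    (h₁ : Continuous g₁) (h₂ : Continuous g₂) (h₃ : Continuous g₃) (a b : ℝ) :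
    Continuous fun x => vertex a b (g₁ x) (g₂ x) (g₃ x) := by
  unfold vertex; fun_prop

/-- The resonance function `Ω = ω₁ + ω₂ − ω₃ − ω₄` is jointly continuous along continuous
arguments. [folklore] -/
@[fun_prop]
theorem levelShift_continuous_resonanceFn {X : Type*} [TopologicalSpace X] {g₁ g₂ g₃ : X → ℝ}
    (h₁ : Continuous g₁) (h₂ : Continuous g₂) (h₃ : Continuous g₃) (ω₂ : ℝ) :
    Continuous fun x => resonanceFn ω₂ (g₁ x) (g₂ x) (g₃ x) := by
  unfold resonanceFn; fun_prop

/-! ### Integration over the cell `(−π,π]³` as an iterated product -/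

/-- A continuous function on `ℝ³` is integrable over the cell `(−π,π]³`, written as the iterated
product `dk₁ (dk₃ dk₂)` of Lebesgue measure restricted to `(−π,π]`: the product of the restrictions
is the restriction of Lebesgue measure on `ℝ³` to the (bounded) cube, which sits in the compact closed
cube. [folklore] -/
theorem levelShift_integrable_cell {G : ℝ × ℝ × ℝ → ℝ} (hG : Continuous G) :
    Integrable G ((volume.restrict (Set.Ioc (-Real.pi) Real.pi)).prod
      ((volume.restrict (Set.Ioc (-Real.pi) Real.pi)).prod
        (volume.restrict (Set.Ioc (-Real.pi) Real.pi)))) := by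
  rw [Measure.prod_restrict, Measure.prod_restrict]
  have hK : IsCompact (Set.Icc (-Real.pi) Real.pi ×ˢ
      (Set.Icc (-Real.pi) Real.pi ×ˢ Set.Icc (-Real.pi) Real.pi)) :=
    isCompact_Icc.prod (isCompact_Icc.prod isCompact_Icc)
  exact (hG.continuousOn.integrableOn_compact hK).mono_set
    (Set.prod_mono Set.Ioc_subset_Icc_self
      (Set.prod_mono Set.Ioc_subset_Icc_self Set.Ioc_subset_Icc_self))

/-- Fubini on the cell: for continuous `G` on `ℝ³` the iterated integral `∫ dk₁ ∫ dk₃ ∫ dk₂ G(k₁,(k₃,k₂))`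
over `(−π,π]` in each variable is the integral of `G` against the iterated product measure. [folklore] -/
theorem levelShift_integral_cell {G : ℝ × ℝ × ℝ → ℝ} (hG : Continuous G) :
    ∫ k₁ in Set.Ioc (-Real.pi) Real.pi, ∫ k₃ in Set.Ioc (-Real.pi) Real.pi,
        ∫ k₂ in Set.Ioc (-Real.pi) Real.pi, G (k₁, k₃, k₂) =
      ∫ p, G p ∂((volume.restrict (Set.Ioc (-Real.pi) Real.pi)).prod
        ((volume.restrict (Set.Ioc (-Real.pi) Real.pi)).prod
          (volume.restrict (Set.Ioc (-Real.pi) Real.pi)))) := by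
  have hI := levelShift_integrable_cell hG
  rw [integral_prod G hI]
  refine integral_congr_ae ?_
  filter_upwards [hI.prod_right_ae] with k₁ hk₁
  exact (integral_prod _ hk₁).symm

/-! ### The pushforward of a weighted measure -/

/-- Integration against the image under a continuous `Ω` of the measure `W · μ` (`W ≥ 0` continuous):
`∫ P d(Ω_*(W μ)) = ∫ W · (P ∘ Ω) dμ` for continuous `P`. [folklore] -/
theorem levelShift_integral_map_withDensity {μ : Measure (ℝ × ℝ × ℝ)} {W Ω : ℝ × ℝ × ℝ → ℝ}
    {P : ℝ → ℝ} (hW : Continuous W) (hW0 : ∀ p, 0 ≤ W p) (hΩ : Continuous Ω) (hP : Continuous P) :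
    ∫ x, P x ∂((μ.withDensity fun p => ENNReal.ofReal (W p)).map Ω) = ∫ p, W p * P (Ω p) ∂μ := by
  rw [integral_map hΩ.measurable.aemeasurable hP.aestronglyMeasurable]
  have : (fun p => ENNReal.ofReal (W p)) = fun p => ((fun p => (W p).toNNReal) p : ℝ≥0∞) := rfl
  rw [this, integral_withDensity_eq_integral_smul hW.measurable.real_toNNReal]
  refine integral_congr_ae (ae_of_all _ fun p => ?_)
  simp only [NNReal.smul_def, smul_eq_mul, Real.coe_toNNReal _ (hW0 p)]

/-- The image under any map `Ω` of the weighted cell measure `W · dk` on `(−π,π]³` with a continuous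
weight `W` is a finite measure (`W` is integrable on the bounded cell). [folklore] -/
theorem levelShift_isFiniteMeasure_map {W : ℝ × ℝ × ℝ → ℝ} (Ω : ℝ × ℝ × ℝ → ℝ) (hW : Continuous W) :
    IsFiniteMeasure ((((volume.restrict (Set.Ioc (-Real.pi) Real.pi)).prod
      ((volume.restrict (Set.Ioc (-Real.pi) Real.pi)).prod
        (volume.restrict (Set.Ioc (-Real.pi) Real.pi)))).withDensity
          fun p => ENNReal.ofReal (W p)).map Ω) := by
  have := isFiniteMeasure_withDensity_ofReal (levelShift_integrable_cell hW).hasFiniteIntegral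
  infer_instance

/-! ### The registered stub -/

/-- **Stub B0 of line `swap-odd-threshold-rigidity` (`stub_levelShiftPushforward`).** For `ω₂ > 0`
and a continuous profile `f`, the pushforward `m_f = Ω_*(W dk)` of the weight
`W = Φ²/(ω₁ω₂ω₃ω₄)²·[f]²` on the cell `(−π,π]³` (read at `p = (k₁,(k₃,k₂))`) under the resonance
function `Ω` is a finite measure on `ℝ`, and for every `ν > 0`, `E ∈ ℝ` the Poisson-regularised
bracket-weighted pair spectral function `∫∫∫ W · ν/((Ω − E)² + ν²) dk₂ dk₃ dk₁` is the Poisson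
integral `∫ ν/((x − E)² + ν²) dm_f(x)`. [folklore] -/
theorem stub_levelShiftPushforward :
    ∀ ω₂ a b : ℝ, 0 < ω₂ → ∀ f : ℝ → ℝ, Continuous f →
      MeasureTheory.IsFiniteMeasure
        (MeasureTheory.Measure.map (fun p : ℝ × ℝ × ℝ => resonanceFn ω₂ p.1 p.2.2 p.2.1)
            (((volume.restrict (Set.Ioc (-Real.pi) Real.pi)).prod
                ((volume.restrict (Set.Ioc (-Real.pi) Real.pi)).prod
                  (volume.restrict (Set.Ioc (-Real.pi) Real.pi)))).withDensity
              (fun p : ℝ × ℝ × ℝ => ENNReal.ofReal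
                (vertex a b p.1 p.2.2 p.2.1 ^ 2 /
                    (dispersion ω₂ p.1 * dispersion ω₂ p.2.2 * dispersion ω₂ p.2.1 *
                      dispersion ω₂ (p.1 + p.2.2 - p.2.1)) ^ 2 *
                  (f p.1 + f p.2.2 - f p.2.1 - f (p.1 + p.2.2 - p.2.1)) ^ 2)))) ∧
      ∀ ν : ℝ, 0 < ν → ∀ E : ℝ,
        (∫ k₁ in Set.Ioc (-Real.pi) Real.pi, ∫ k₃ in Set.Ioc (-Real.pi) Real.pi,
            ∫ k₂ in Set.Ioc (-Real.pi) Real.pi,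
              vertex a b k₁ k₂ k₃ ^ 2 /
                  (dispersion ω₂ k₁ * dispersion ω₂ k₂ * dispersion ω₂ k₃ * dispersion ω₂ (k₁ + k₂ - k₃)) ^ 2 *
                (f k₁ + f k₂ - f k₃ - f (k₁ + k₂ - k₃)) ^ 2 *
                (ν / ((resonanceFn ω₂ k₁ k₂ k₃ - E) ^ 2 + ν ^ 2))) =
          ∫ x, ν / ((x - E) ^ 2 + ν ^ 2) ∂(MeasureTheory.Measure.map (fun p : ℝ × ℝ × ℝ => resonanceFn ω₂ p.1 p.2.2 p.2.1)
            (((volume.restrict (Set.Ioc (-Real.pi) Real.pi)).prod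
                ((volume.restrict (Set.Ioc (-Real.pi) Real.pi)).prod
                  (volume.restrict (Set.Ioc (-Real.pi) Real.pi)))).withDensity
              (fun p : ℝ × ℝ × ℝ => ENNReal.ofReal
                (vertex a b p.1 p.2.2 p.2.1 ^ 2 /
                    (dispersion ω₂ p.1 * dispersion ω₂ p.2.2 * dispersion ω₂ p.2.1 *
                      dispersion ω₂ (p.1 + p.2.2 - p.2.1)) ^ 2 *
                  (f p.1 + f p.2.2 - f p.2.1 - f (p.1 + p.2.2 - p.2.1)) ^ 2)))) := by
  intro ω₂ a b hω f hf
  -- the denominator `(ω₁ω₂ω₃ω₄)²` never vanishes (the band is gapped)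
  have hden : ∀ p : ℝ × ℝ × ℝ, (dispersion ω₂ p.1 * dispersion ω₂ p.2.2 * dispersion ω₂ p.2.1 *
      dispersion ω₂ (p.1 + p.2.2 - p.2.1)) ^ 2 ≠ 0 := fun p =>
    pow_ne_zero _ (mul_pos (mul_pos (mul_pos (dispersion_pos hω _) (dispersion_pos hω _))
      (dispersion_pos hω _)) (dispersion_pos hω _)).ne'
  -- continuity of the three factors of the weight, of the weight, and of `Ω`
  have hV : Continuous fun p : ℝ × ℝ × ℝ => vertex a b p.1 p.2.2 p.2.1 ^ 2 := by fun_prop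
  have hD : Continuous fun p : ℝ × ℝ × ℝ => (dispersion ω₂ p.1 * dispersion ω₂ p.2.2 *
      dispersion ω₂ p.2.1 * dispersion ω₂ (p.1 + p.2.2 - p.2.1)) ^ 2 := by fun_prop
  have hB : Continuous fun p : ℝ × ℝ × ℝ =>
      (f p.1 + f p.2.2 - f p.2.1 - f (p.1 + p.2.2 - p.2.1)) ^ 2 := by fun_prop
  have hW : Continuous fun p : ℝ × ℝ × ℝ => vertex a b p.1 p.2.2 p.2.1 ^ 2 /
      (dispersion ω₂ p.1 * dispersion ω₂ p.2.2 * dispersion ω₂ p.2.1 *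
        dispersion ω₂ (p.1 + p.2.2 - p.2.1)) ^ 2 *
      (f p.1 + f p.2.2 - f p.2.1 - f (p.1 + p.2.2 - p.2.1)) ^ 2 := (hV.div hD hden).mul hB
  have hW0 : ∀ p : ℝ × ℝ × ℝ, 0 ≤ vertex a b p.1 p.2.2 p.2.1 ^ 2 /
      (dispersion ω₂ p.1 * dispersion ω₂ p.2.2 * dispersion ω₂ p.2.1 *
        dispersion ω₂ (p.1 + p.2.2 - p.2.1)) ^ 2 *
      (f p.1 + f p.2.2 - f p.2.1 - f (p.1 + p.2.2 - p.2.1)) ^ 2 := fun p => by positivity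
  have hΩ : Continuous fun p : ℝ × ℝ × ℝ => resonanceFn ω₂ p.1 p.2.2 p.2.1 := by fun_prop
  refine ⟨levelShift_isFiniteMeasure_map _ hW, fun ν hν E => ?_⟩
  -- the Poisson kernel is continuous
  have hP : Continuous fun x : ℝ => ν / ((x - E) ^ 2 + ν ^ 2) :=
    continuous_const.div (by fun_prop) fun x => by positivity
  rw [levelShift_integral_map_withDensity hW hW0 hΩ hP]
  exact levelShift_integral_cell (hW.mul (hP.comp hΩ))

end Summit.AtomisticToContinuum.FouriersLaw.Theorems.MourreDissolution

end
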